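import Mathlib
import Summits.KontsevichZagierPeriods.Zeta5Search.AperyFrobeniusFactorisation

/-!
# BrickKernelFrobenius — the Frobenius factorisation `R_{np}(pt) = p^{ε−A}·Φ_{n,p}(t)·R_n(t)` for the general
brick kernel `R_n^{(A,B,ε)}` (cell zeta5-irr)

HONEST FRAMING: systematic search; no irrationality claim unless certified. INSTRUMENT lemma of the ζ(5)
census cell zeta5-irr (HOME `run/shared/lean/pub/zeta5-irr/`; memo `zi-p2/LEMMAS.md` §B8-a THEOREM 2 (i); it is
«Step B» of zi-p2's THEOREM 4 and THEOREM 5, asked for in this generality by zi-p2 g10, HOME INBOX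
2026-08-26T18:39:10Z). Nothing here is about ζ(5); no irrationality content; filing moves no rung. Filed by the
cell's engine seat zi-eng (g6).

## The statement (zi-p2 LEMMAS §B8-a THEOREM 2 (i), in the `(pt ± ℓ)` normalisation of the tree file
`AperyFrobeniusFactorisation`)

For integers `A ≥ 2B ≥ 0`, `ε ∈ ℕ` (the cell uses `ε ∈ {0,1}`) and the brick kernel
`R_n(t) = R_n^{(A,B,ε)}(t) = (n!)^{A−2B} · (t + n/2)^ε · ((t−n)_n)^B · ((t+n+1)_n)^B / ((t)_{n+1})^A`
`= (n!)^{A−2B} (t + n/2)^ε ∏_{m=1}^{n}(t−m)^B ∏_{m=1}^{n}(t+n+m)^B / ∏_{m=0}^{n}(t+m)^A`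
(Ball–Rivoal / Zudilin very-well-poised bricks; `(A,B,ε) = (4,1,1)` is Ball's `ζ(3)` kernel, `(6,1,1)`, `(6,2,1)`,
`(8,1,1)` the odd-zeta kernels of the cell's B8 probes; the Apéry kernels of `AperyFrobeniusFactorisation` are the
`B`-free relatives), and every `p ≥ 1`, `n`:
`p^A · R_{np}(pt) = p^ε · Φ_{n,p}(t) · R_n(t)`,
`Φ_{n,p}(t) = W^{A−2B} · ∏_{p∤ℓ≤np}(pt−ℓ)^B · ∏_{p∤ℓ≤np}(pt+np+ℓ)^B / ∏_{p∤ℓ≤np}(pt+ℓ)^A`, `W = ∏_{1≤ℓ≤np, p∤ℓ} ℓ`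
(zi-p2 writes `Φ` with factors `(t ∓ ℓ/p)`; the two normalisations differ by the power `p^{(np−n)(2B−A)}` displayed in
the INBOX line).  «The pure product identity over `ℚ(t)` needs no `p`-adics.»

## What is PROVED here (everything; standard axioms)

* `prod_Icc_mul_add_mul` — the third splitting `∏_{m≤np}(pt+np+m) = pⁿ·∏_{m≤n}(t+n+m)·∏_{p∤ℓ}(pt+np+ℓ)`
  (the other two and `(np)! = pⁿ n! W` are the tree's `FrobeniusFactorisation.prod_Icc_mul_sub`,
  `prod_range_mul_add`, `factorial_mul_eq`);
* `brickKernel A B ε n t`, `brickPhi A B p n t` and **`brickKernel_frobenius`**: for `2B ≤ A`, `(p : K) ≠ 0` and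
  EVERY `t` (poles included, by `x/0 = 0`): `p^A · R_{np}(pt) = p^ε · Φ_{n,p}(t) · R_n(t)`.

Not covered: the digit/off-digit local analysis of `Φ_{n,p}` (THEOREM 2 (ii), THEOREM3 Steps 2–4; the value part at
digit points for the Apéry kernels is in `AperyFrobeniusFactorisation`).
-/

namespace Summit.KontsevichZagierPeriods.Zeta5Search.BrickKernelFrobenius

open Finset Nat
open Summit.KontsevichZagierPeriods.Zeta5Search.FrobeniusFactorisation (prod_Icc_mul_eq_mul_prod_filter
  prod_Icc_mul_sub prod_range_mul_add factorial_mul_eq)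

/-- **Shifted numerator**: `∏_{1≤m≤np}(pt + np + m) = pⁿ · ∏_{1≤m≤n}(t + n + m) · ∏_{1≤ℓ≤np, p∤ℓ}(pt + np + ℓ)` in any
commutative ring, for `p ≥ 1`. -/
theorem prod_Icc_mul_add_mul {R : Type*} [CommRing R] {p : ℕ} (hp : 0 < p) (n : ℕ) (t : R) :
    ∏ m ∈ Icc 1 (n * p), ((p : R) * t + (n * p : ℕ) + m) =
      (p : R) ^ n * (∏ m ∈ Icc 1 n, (t + n + m)) *
        ∏ m ∈ (Icc 1 (n * p)).filter (fun m => ¬ p ∣ m), ((p : R) * t + (n * p : ℕ) + m) := by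
  rw [prod_Icc_mul_eq_mul_prod_filter hp n (fun m => (p : R) * t + (n * p : ℕ) + m)]
  congr 1
  have h : ∀ m ∈ Icc 1 n, ((p : R) * t + ((n * p : ℕ) : R) + ((p * m : ℕ) : R)) = (p : R) * (t + n + m) := by
    intro m _; push_cast; ring
  rw [Finset.prod_congr rfl h, Finset.prod_mul_distrib, Finset.prod_const, Nat.card_Icc, Nat.add_sub_cancel]

section kernel

variable {K : Type*} [Field K]

/-- The general brick kernel `R_n^{(A,B,ε)}(t) = (n!)^{A−2B}(t+n/2)^ε ∏_{m=1}^{n}(t−m)^B ∏_{m=1}^{n}(t+n+m)^B / ∏_{m=0}^{n}(t+m)^A`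
(`= (n!)^{A−2B}(t+n/2)^ε((t−n)_n)^B((t+n+1)_n)^B/((t)_{n+1})^A`). -/
def brickKernel (A B ε n : ℕ) (t : K) : K :=
  (n ! : K) ^ (A - 2 * B) * (t + (n : K) / 2) ^ ε * (∏ m ∈ Icc 1 n, (t - m)) ^ B *
      (∏ m ∈ Icc 1 n, (t + n + m)) ^ B / (∏ m ∈ range (n + 1), (t + m)) ^ A

/-- The Frobenius factor `Φ_{n,p}(t) = W^{A−2B} ∏_{p∤ℓ}(pt−ℓ)^B ∏_{p∤ℓ}(pt+np+ℓ)^B / ∏_{p∤ℓ}(pt+ℓ)^A`,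
`W = ∏_{1≤ℓ≤np, p∤ℓ} ℓ`. -/
def brickPhi (A B p n : ℕ) (t : K) : K :=
  (((∏ m ∈ (Icc 1 (n * p)).filter (fun m => ¬ p ∣ m), m : ℕ) : K)) ^ (A - 2 * B) *
      (∏ m ∈ (Icc 1 (n * p)).filter (fun m => ¬ p ∣ m), ((p : K) * t - m)) ^ B *
      (∏ m ∈ (Icc 1 (n * p)).filter (fun m => ¬ p ∣ m), ((p : K) * t + (n * p : ℕ) + m)) ^ B /
    (∏ m ∈ (Icc 1 (n * p)).filter (fun m => ¬ p ∣ m), ((p : K) * t + m)) ^ A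

/-- The algebra: for `x ≠ 0` and all `a a' b c c' d e w h`,
`x^{C+2B} · [(xⁿ e w)^C h (xⁿ a c)^B (xⁿ a' c')^B / (x^{n+1} b d)^{C+2B}] = (w^C c^B c'^B / d^{C+2B}) · (e^C h a^B a'^B / b^{C+2B})`
(both sides vanish when `b = 0` or `d = 0` and `C + 2B ≥ 1`). [folklore] -/
private theorem algebra {x : K} (hx : x ≠ 0) (n B C : ℕ) (a a' b c c' d e w h : K) :
    x ^ (C + 2 * B) * ((x ^ n * e * w) ^ C * h * (x ^ n * a * c) ^ B * (x ^ n * a' * c') ^ B /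
        (x ^ (n + 1) * b * d) ^ (C + 2 * B)) =
      (w ^ C * c ^ B * c' ^ B / d ^ (C + 2 * B)) * (e ^ C * h * a ^ B * a' ^ B / b ^ (C + 2 * B)) := by
  rcases Nat.eq_zero_or_pos (C + 2 * B) with h0 | h0
  · have hC : C = 0 := by omega
    have hB : B = 0 := by omega
    subst hC; subst hB
    simp
  by_cases hb : b = 0
  · subst hb; simp [zero_pow h0.ne']
  by_cases hd : d = 0
  · subst hd; simp [zero_pow h0.ne']
  field_simp
  ring

/-- **Frobenius factorisation of the brick kernel** (zi-p2 LEMMAS §B8-a THEOREM 2 (i); «Step B» of THEOREMS 4/5): for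
`2B ≤ A`, `p ≥ 1` invertible in `K`, and every `n`, `t`:  `p^A · R_{np}(pt) = p^ε · Φ_{n,p}(t) · R_n(t)`. -/
theorem brickKernel_frobenius {A B : ℕ} (hAB : 2 * B ≤ A) (ε : ℕ) {p : ℕ} (hp : 0 < p) (hpK : (p : K) ≠ 0)
    (n : ℕ) (t : K) :
    (p : K) ^ A * brickKernel A B ε (n * p) ((p : K) * t) =
      (p : K) ^ ε * brickPhi A B p n t * brickKernel A B ε n t := by
  obtain ⟨C, rfl⟩ : ∃ C, A = C + 2 * B := ⟨A - 2 * B, by omega⟩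
  unfold brickKernel brickPhi
  rw [Nat.add_sub_cancel, prod_Icc_mul_sub hp n t, prod_range_mul_add hp n t, prod_Icc_mul_add_mul hp n t,
    factorial_mul_eq hp n]
  -- the very-well-poised factor: `pt + (np)/2 = p (t + n/2)`
  have hvwp : ((p : K) * t + ((n * p : ℕ) : K) / 2) ^ ε = (p : K) ^ ε * (t + (n : K) / 2) ^ ε := by
    rw [← mul_pow]; congr 1; push_cast; ring
  rw [hvwp]
  push_cast
  have key := algebra hpK n B C (∏ m ∈ Icc 1 n, (t - (m : K))) (∏ m ∈ Icc 1 n, (t + n + (m : K)))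
    (∏ m ∈ range (n + 1), (t + (m : K)))
    (∏ m ∈ (Icc 1 (n * p)).filter (fun m => ¬ p ∣ m), ((p : K) * t - (m : K)))
    (∏ m ∈ (Icc 1 (n * p)).filter (fun m => ¬ p ∣ m), ((p : K) * t + (n : K) * (p : K) + (m : K)))
    (∏ m ∈ (Icc 1 (n * p)).filter (fun m => ¬ p ∣ m), ((p : K) * t + (m : K)))
    (n ! : K) (∏ m ∈ (Icc 1 (n * p)).filter (fun m => ¬ p ∣ m), (m : K))
    ((p : K) ^ ε * (t + (n : K) / 2) ^ ε)
  linear_combination key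

end kernel

/-- Sanity instance (`(A,B,ε) = (4,1,1)` = Ball's `ζ(3)` kernel, `n = 1`, `p = 2`, `t = 3` in `ℚ`). -/
example : (2 : ℚ) ^ 4 * brickKernel 4 1 1 (1 * 2) ((2 : ℚ) * 3) =
    (2 : ℚ) ^ 1 * brickPhi 4 1 2 1 (3 : ℚ) * brickKernel 4 1 1 1 (3 : ℚ) :=
  brickKernel_frobenius (by norm_num) 1 (by norm_num) (by norm_num) 1 3

end Summit.KontsevichZagierPeriods.Zeta5Search.BrickKernelFrobenius
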